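import Literature.Probability.Percolation.ZdFrontierEvent
import Literature.Probability.Percolation.DisjointOccurrencePow
import Literature.Probability.Percolation.ZdGeneralRSW
import Literature.Probability.Percolation.Z2HalfPlaneTwoArm
import Literature.NumberTheory.LFunctions.GeometricBlocks
import HarnessLib

/-!
# There cannot be too many crossing clusters: `Σ_S P(E_S) ≤ q + q² + ⋯`, `q = P(LR) ≤ 1 - c`

Topic `Literature/Probability/Percolation`; bond percolation on `ℤ² = Site 2` at `p = 1/2`.
DEFINITIONS with bodies (`frontierFamily`) and PROOFS (no named fact).  A brick of the EXTERNAL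
per-scale lemma of Kesten's arm-separation theorem for four alternating arms of bond percolation
on `ℤ²`, in the cluster–frontier form of `ZdFrontierEvent.lean` (one colour at a time): the
first step of the proof of P. Nolin, EJP 13 (2008), §4.4, Lemma 15 [arXiv 0711.4948: Lemma 14,
p. 11] — "First we note that there cannot be too many disjoint crossings in `U_N`. Indeed, the
probability of crossing this domain is less than some `1 - δ'` (by RSW): combined with the BK
inequality, this implies that the probability of observing at least `h` crossings is less than
`(1 - δ')^h`" — in the form consumed by the union bound over frontiers `S` of the events
`E_S = frontierEvent M N S`:

* `eq_of_mem_frontierEvent_of_mem_edgeVerts` — two frontier sets whose events hold at `ω` and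
  which share a VERTEX are equal (they seed the same cluster, whose low edges they both are);
  hence distinct realised frontier sets are vertex- and edge-disjoint;
* `IsFrontierSet.coe_mem_lrCrossing` — a frontier set is (the edge set of) an open left–right
  crossing: `↑S ∈ lrCrossing M N`;
* `mem_disjointOccurrencePow_of_le_card_realised` — if `k` frontier events hold at `ω`, the
  left–right crossing occurs `k` times disjointly, `ω ∈ LR □ ⋯ □ LR`
  (`mem_disjointOccurrencePow_of_pairwise_disjoint`);
* `sum_real_frontierEvent_le` — **`Σ_{S} P_{1/2}(E_S) ≤ Σ_{k ≥ 1} P_{1/2}(LR(R))^k`** (the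
  expected number of crossing clusters, by the layer-cake formula and the iterated BK–Reimer
  inequality `measureReal_disjointOccurrencePow_le`), and `sum_real_frontierEvent_le_of_le`:
  `≤ q / (1 - q)` whenever `P(LR(R)) ≤ q < 1`;
* `exists_crossingProb_half_le_one_sub` — **`P_{1/2}(LR([0,M] × [0,N])) ≤ 1 - c₉`** for
  `N + 2 ≤ 9 M` (duality `crossingProb_add_crossingProb_symm_holds` and the RSW lower bound
  `rsw_lowerBound_holds` for the long way across the `9 × 1` rectangle): Nolin's `1 - δ'`.

## References

* P. Nolin, *Near-critical percolation in two dimensions*, EJP 13 (2008), §4.4, proof of Lemma 15,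
  first paragraph (arXiv 0711.4948: Lemma 14, p. 11) [Nolin2008].
* H. Kesten, *Scaling relations for 2D-percolation*, CMP 109 (1987), §2, proof of Lemma 4
  [KestenScalingCMP1987].
* G. Grimmett, *Percolation*, 2nd ed. (1999), Thm. 2.12/(2.14) (iterated BK inequality)
  [GrimmettPercolation1999].
* B. Bollobás, O. Riordan, *Percolation* (2006), Ch. 3, Cor. 3 and Thm. 8 (RSW at `p = 1/2`)
  [BollobasRiordan2006].

## Tree

`frontierEvent`, `IsFrontierSet`, `clusterConfig`, `clusterConfig_eq_of_subset`,
`measurableSet_frontierEvent` (`ZdFrontierEvent.lean`); `LowPath`, `nonempty_lowPath`,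
`LowPath.mem_support_iff` (`ZdLowestFrontier.lean`); `disjointOccurrencePow`,
`mem_disjointOccurrencePow_of_pairwise_disjoint`, `measureReal_disjointOccurrencePow_le`
(`DisjointOccurrencePow.lean`); `lrCrossing`, `crossingProb`, `isLocalEvent_lrCrossing`,
`crossingProb_add_crossingProb_symm_holds`, `rsw_lowerBound_holds`, `crossingProb_anti_left`.
`Z2HalfPlane.sum_range_ite_succ_le` (`Z2HalfPlaneTwoArm.lean`), `VdC.sum_pow_succ_le`
(`NumberTheory/LFunctions/GeometricBlocks.lean`). Mathlib: `integral_finsetSum`, `integral_indicator_const`.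
-/

noncomputable section

open SimpleGraph Finset

namespace Literature.Probability.Percolation

open LatticeModels

variable {M N : ℕ} {ω : BondConfig (Site 2)} {S S' : Finset (Sym2 (Site 2))}

/-! ### Frontier sets are open left–right crossings; realised frontier sets are disjoint -/

namespace IsFrontierSet

/-- The vertices of a frontier set are the vertices of its lowest crossing. [folklore] -/
theorem mem_edgeVerts_iff_mem_support (hS : IsFrontierSet M N S) (hM : 1 ≤ M)
    (Λ : LowPath M N (↑S : BondConfig (Site 2))) {x : Site 2} :
    x ∈ edgeVerts (↑S : Set (Sym2 (Site 2))) ↔ x ∈ Λ.path.support := by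
  rw [Λ.mem_support_iff hM, hS.isLowVertex_coe_iff]

/-- The edges of the lowest crossing of `↑S` are the edges of `S`. [folklore] -/
theorem mem_edges_iff (hS : IsFrontierSet M N S) (Λ : LowPath M N (↑S : BondConfig (Site 2)))
    {e : Sym2 (Site 2)} : e ∈ Λ.path.edges ↔ e ∈ S := by
  rw [Λ.mem_edges_iff, hS.1]

/-- **Two vertices of a frontier set are joined along it**: by a lattice walk inside `R` whose
edges are edges of `S`. [folklore] -/
theorem exists_walk_of_mem_edgeVerts (hS : IsFrontierSet M N S) (hM : 1 ≤ M) {y y' : Site 2}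
    (hy : y ∈ edgeVerts (↑S : Set (Sym2 (Site 2)))) (hy' : y' ∈ edgeVerts (↑S : Set (Sym2 (Site 2)))) :
    ∃ W : (zdGraph 2).Walk y y', (∀ z ∈ W.support, z ∈ rectangle M N) ∧ ∀ e ∈ W.edges, e ∈ S := by
  classical
  obtain ⟨Λ⟩ := nonempty_lowPath (ω := (↑S : BondConfig (Site 2))) hM hS.2
  obtain ⟨U, hUs, hUe⟩ := exists_walk_within_support Λ.path ((hS.mem_edgeVerts_iff_mem_support hM Λ).1 hy)
    ((hS.mem_edgeVerts_iff_mem_support hM Λ).1 hy')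
  exact ⟨U, fun z hz => Λ.mem_rectangle z (hUs z hz), fun e he => (hS.mem_edges_iff Λ).1 (hUe e he)⟩

/-- **A frontier set is an open left–right crossing of `R`**: the configuration `↑S` lies in
`lrCrossing M N`. [folklore] -/
theorem coe_mem_lrCrossing (hS : IsFrontierSet M N S) (hM : 1 ≤ M) :
    (↑S : BondConfig (Site 2)) ∈ lrCrossing M N := by
  obtain ⟨Λ⟩ := nonempty_lowPath (ω := (↑S : BondConfig (Site 2))) hM hS.2
  have ha := Λ.mem_rectangle _ Λ.path.start_mem_support
  have hb := Λ.mem_rectangle _ Λ.path.end_mem_support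
  refine ⟨Λ.a, Finset.mem_coe.2 (Finset.mem_filter.2 ⟨ha, Λ.left⟩), Λ.b,
    Finset.mem_coe.2 (Finset.mem_filter.2 ⟨hb, Λ.right⟩), ?_⟩
  exact mem_openConnIn_of_walk Λ.path (fun z hz => Finset.mem_coe.2 (Λ.mem_rectangle z hz))
    fun e he => Finset.mem_coe.2 ((hS.mem_edges_iff Λ).1 he)

end IsFrontierSet

/-- **Realised frontier sets sharing a vertex are equal.**  If the frontier events of two
frontier sets `S`, `S'` hold at `ω` and a vertex of `S` is a vertex of `S'`, then `S = S'`: both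
seed the same open cluster of `R` (`clusterConfig_eq_of_subset`), of which both are the set of
low edges. [folklore] -/
theorem eq_of_mem_frontierEvent_of_mem_edgeVerts (hM : 1 ≤ M) (hS : IsFrontierSet M N S)
    (hS' : IsFrontierSet M N S') (hω : ω ∈ frontierEvent M N S) (hω' : ω ∈ frontierEvent M N S')
    {y₀ : Site 2} (hy₀ : y₀ ∈ edgeVerts (↑S : Set (Sym2 (Site 2))))
    (hy₀' : y₀ ∈ edgeVerts (↑S' : Set (Sym2 (Site 2)))) : S = S' := by
  -- the vertices of `S'` are pairwise joined in `(R, ω)` along `S'`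
  have hT : ∀ y ∈ edgeVerts (↑S' : Set (Sym2 (Site 2))), ∀ y' ∈ edgeVerts (↑S' : Set (Sym2 (Site 2))),
      ∃ W : (zdGraph 2).Walk y y', (∀ z ∈ W.support, z ∈ rectangle M N) ∧ ∀ e ∈ W.edges, e ∈ ω := by
    intro y hy y' hy'
    obtain ⟨W, hWR, hWe⟩ := hS'.exists_walk_of_mem_edgeVerts hM hy hy'
    exact ⟨W, hWR, fun e he => hω'.1 (Finset.mem_coe.2 (hWe e he))⟩
  -- `S` lies in the cluster configuration of `S'`
  have hST : (↑S : Set (Sym2 (Site 2))) ⊆ clusterConfig M N ω S' := by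
    intro e he
    have he' : e ∈ S := Finset.mem_coe.1 he
    have hE : e ∈ (zdGraph 2).edgeSet := hS.subset_edgeSet he
    have hR := hS.mem_rectangle he'
    induction e using Sym2.ind with
    | h x x' =>
      obtain ⟨W, hWR, hWe⟩ := hS.exists_walk_of_mem_edgeVerts hM hy₀ ⟨_, he, Sym2.mem_mk_left _ _⟩
      exact ⟨hω.1 he, hE, hR, x, Sym2.mem_mk_left _ _, y₀, hy₀', W, hWR,
        fun e' he'' => hω.1 (Finset.mem_coe.2 (hWe e' he''))⟩
  have hSne : S.Nonempty := by
    obtain ⟨s, hs, -⟩ := hy₀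
    exact ⟨s, Finset.mem_coe.1 hs⟩
  have heq := clusterConfig_eq_of_subset hT hST hSne
  ext e
  rw [← hω.2 e, heq, hω'.2 e]

/-- **Distinct realised frontier sets are vertex-disjoint**, hence edge-disjoint. [folklore] -/
theorem disjoint_coe_of_mem_frontierEvent (hM : 1 ≤ M) (hS : IsFrontierSet M N S) (hS' : IsFrontierSet M N S')
    (hω : ω ∈ frontierEvent M N S) (hω' : ω ∈ frontierEvent M N S') (hne : S ≠ S') :
    Disjoint (↑S : Set (Sym2 (Site 2))) ↑S' := by
  rw [Set.disjoint_left]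
  intro e he he'
  induction e using Sym2.ind with
  | h x x' =>
    exact hne (eq_of_mem_frontierEvent_of_mem_edgeVerts hM hS hS' hω hω' ⟨_, he, Sym2.mem_mk_left _ _⟩
      ⟨_, he', Sym2.mem_mk_left _ _⟩)

/-! ### The family of frontier sets; `k` realised frontiers give `k` disjoint crossings -/

open Classical in
/-- **The frontier sets of `R = [0,M] × [0,N]`**: the finite family of all frontier sets (each
is a set of pairs of sites of `R`). [folklore] -/
def frontierFamily (M N : ℕ) : Finset (Finset (Sym2 (Site 2))) :=
  ((rectangle M N).sym2.powerset).filter fun S => IsFrontierSet M N S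

/-- Membership in `frontierFamily`: exactly the frontier sets. [folklore] -/
theorem mem_frontierFamily_iff : S ∈ frontierFamily M N ↔ IsFrontierSet M N S := by
  classical
  rw [frontierFamily, Finset.mem_filter, Finset.mem_powerset]
  refine ⟨fun h => h.2, fun h => ⟨fun e he => ?_, h⟩⟩
  induction e using Sym2.ind with
  | h x y =>
    exact Finset.mk_mem_sym2_iff.2 ⟨h.mem_rectangle he x (Sym2.mem_mk_left _ _),
      h.mem_rectangle he y (Sym2.mem_mk_right _ _)⟩

open Classical in
/-- The frontier sets realised at `ω`. [folklore] -/
def realisedFrontiers (M N : ℕ) (ω : BondConfig (Site 2)) : Finset (Finset (Sym2 (Site 2))) :=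
  (frontierFamily M N).filter fun S => ω ∈ frontierEvent M N S

/-- Membership in `realisedFrontiers`. [folklore] -/
theorem mem_realisedFrontiers_iff : S ∈ realisedFrontiers M N ω ↔ IsFrontierSet M N S ∧ ω ∈ frontierEvent M N S := by
  classical
  rw [realisedFrontiers, Finset.mem_filter, mem_frontierFamily_iff]

/-- `realisedFrontiers ⊆ frontierFamily`. [folklore] -/
theorem card_realisedFrontiers_le : (realisedFrontiers M N ω).card ≤ (frontierFamily M N).card := by
  classical
  exact Finset.card_le_card (Finset.filter_subset _ _)

/-- **`k` realised frontiers give `k` disjoint open left–right crossings**: if at least `k`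
frontier events hold at `ω`, then `ω ∈ LR □ ⋯ □ LR` (`k` factors). [cite: Nolin2008, §4.4, proof of Lemma 15, first paragraph (arXiv 0711.4948: Lemma 14, p. 11)] -/
theorem mem_disjointOccurrencePow_of_le_card_realised (hM : 1 ≤ M) {k : ℕ}
    (hk : k ≤ (realisedFrontiers M N ω).card) : ω ∈ disjointOccurrencePow (lrCrossing M N) k := by
  classical
  -- `k` distinct realised frontier sets
  obtain ⟨T, hT, hTk⟩ := Finset.exists_subset_card_eq hk
  let f : Fin k → Finset (Sym2 (Site 2)) := fun i => (T.equivFin.symm (Fin.cast hTk.symm i)).1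
  have hf : ∀ i, f i ∈ realisedFrontiers M N ω := fun i => hT (T.equivFin.symm (Fin.cast hTk.symm i)).2
  have hfinj : Function.Injective f := fun i j h => by
    have := T.equivFin.symm.injective (Subtype.ext h)
    exact Fin.cast_injective _ this
  refine mem_disjointOccurrencePow_of_pairwise_disjoint (isUpperSet_lrCrossing M N)
    (fun i => (↑(f i) : Set (Sym2 (Site 2)))) (fun i => (mem_realisedFrontiers_iff.1 (hf i)).2.1)
    (fun i => (mem_realisedFrontiers_iff.1 (hf i)).1.coe_mem_lrCrossing hM) fun i j hij => ?_
  have hi := mem_realisedFrontiers_iff.1 (hf i)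
  have hj := mem_realisedFrontiers_iff.1 (hf j)
  exact disjoint_coe_of_mem_frontierEvent hM hi.1 hj.1 hi.2 hj.2 fun h => hij (hfinj h)

/-! ### The expected number of crossing clusters -/

section Expectation

open _root_.MeasureTheory

/-- **The expected number of realised frontiers is at most `Σ_{k ≥ 1} P(LR)^k`**:
`Σ_{S ∈ frontierFamily} P_{1/2}(E_S) ≤ Σ_{k < |frontierFamily|} P_{1/2}(LR(R))^{k+1}` (layer cake:
`Σ_S 1_{E_S} = #realised = Σ_k 1_{#realised ≥ k+1} ≤ Σ_k 1_{LR □^{k+1}}`, then iterated BK).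
[cite: Nolin2008, §4.4, proof of Lemma 15, first paragraph (arXiv 0711.4948: Lemma 14, p. 11)] -/
theorem sum_real_frontierEvent_le (hM : 1 ≤ M) :
    ∑ S ∈ frontierFamily M N, (bondPercolation (zdGraph 2) half).real (frontierEvent M N S) ≤
      ∑ k ∈ Finset.range (frontierFamily M N).card, (crossingProb half M N) ^ (k + 1) := by
  classical
  set μ := bondPercolation (zdGraph 2) half with hμ
  set H : ℕ := (frontierFamily M N).card with hH
  have hmeasE : ∀ S ∈ frontierFamily M N, MeasurableSet (frontierEvent M N S) := fun S hS =>
    measurableSet_frontierEvent (mem_frontierFamily_iff.1 hS) hM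
  have hloc : ∀ k, IsLocalEvent (disjointOccurrencePow (lrCrossing M N) k) := fun k =>
    (isLocalEvent_lrCrossing M N).disjointOccurrencePow k
  have hmeasD : ∀ k, MeasurableSet (disjointOccurrencePow (lrCrossing M N) k) := fun k =>
    measurableSet_of_isLocalEvent_holds (hloc k)
  -- pointwise layer cake
  have hpt : ∀ ω, ∑ S ∈ frontierFamily M N, (frontierEvent M N S).indicator (fun _ => (1 : ℝ)) ω ≤
      ∑ k ∈ Finset.range H, (disjointOccurrencePow (lrCrossing M N) (k + 1)).indicator (fun _ => (1 : ℝ)) ω := by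
    intro ω
    have h1 : ∑ S ∈ frontierFamily M N, (frontierEvent M N S).indicator (fun _ => (1 : ℝ)) ω =
        (realisedFrontiers M N ω).card := by
      rw [realisedFrontiers, Finset.card_filter, Nat.cast_sum]
      refine Finset.sum_congr rfl fun S _ => ?_
      by_cases h : ω ∈ frontierEvent M N S <;> simp [h]
    rw [h1, ← Z2HalfPlane.sum_range_ite_succ_le (card_realisedFrontiers_le (ω := ω))]
    refine Finset.sum_le_sum fun k _ => ?_
    by_cases hk : k + 1 ≤ (realisedFrontiers M N ω).card
    · rw [if_pos hk, Set.indicator_of_mem (mem_disjointOccurrencePow_of_le_card_realised hM hk)]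
    · rw [if_neg hk]; exact Set.indicator_nonneg (fun _ _ => zero_le_one) _
  calc ∑ S ∈ frontierFamily M N, μ.real (frontierEvent M N S)
      = ∑ S ∈ frontierFamily M N, ∫ ω, (frontierEvent M N S).indicator (fun _ => (1 : ℝ)) ω ∂μ := by
        refine Finset.sum_congr rfl fun S hS => ?_
        rw [integral_indicator_const _ (hmeasE S hS), smul_eq_mul, mul_one]
    _ = ∫ ω, ∑ S ∈ frontierFamily M N, (frontierEvent M N S).indicator (fun _ => (1 : ℝ)) ω ∂μ :=
        (integral_finsetSum _ fun S hS => (integrable_const _).indicator (hmeasE S hS)).symm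
    _ ≤ ∫ ω, ∑ k ∈ Finset.range H, (disjointOccurrencePow (lrCrossing M N) (k + 1)).indicator
          (fun _ => (1 : ℝ)) ω ∂μ := by
        refine integral_mono_of_nonneg (Filter.Eventually.of_forall fun ω => ?_)
          (integrable_finsetSum _ fun k _ => (integrable_const _).indicator (hmeasD (k + 1)))
          (Filter.Eventually.of_forall hpt)
        exact Finset.sum_nonneg fun S _ => Set.indicator_nonneg (fun _ _ => zero_le_one) _
    _ = ∑ k ∈ Finset.range H, μ.real (disjointOccurrencePow (lrCrossing M N) (k + 1)) := by
        rw [integral_finsetSum _ fun k _ => (integrable_const _).indicator (hmeasD (k + 1))]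
        refine Finset.sum_congr rfl fun k _ => ?_
        rw [integral_indicator_const _ (hmeasD (k + 1)), smul_eq_mul, mul_one]
    _ ≤ ∑ k ∈ Finset.range H, (crossingProb half M N) ^ (k + 1) :=
        Finset.sum_le_sum fun k _ =>
          measureReal_disjointOccurrencePow_le _ _ (isLocalEvent_lrCrossing M N) (k + 1)

/-- **Nolin's bound on the number of crossings, in expectation**: if `P_{1/2}(LR(R)) ≤ q < 1`
then `Σ_S P_{1/2}(E_S) ≤ q / (1 - q)`. [cite: Nolin2008, §4.4, proof of Lemma 15, first paragraph (arXiv 0711.4948: Lemma 14, p. 11)] -/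
theorem sum_real_frontierEvent_le_of_le (hM : 1 ≤ M) {q : ℝ} (hq : crossingProb half M N ≤ q) (hq1 : q < 1) :
    ∑ S ∈ frontierFamily M N, (bondPercolation (zdGraph 2) half).real (frontierEvent M N S) ≤ q / (1 - q) := by
  have hq0 : 0 ≤ crossingProb half M N := measureReal_nonneg
  calc ∑ S ∈ frontierFamily M N, (bondPercolation (zdGraph 2) half).real (frontierEvent M N S)
      ≤ ∑ k ∈ Finset.range (frontierFamily M N).card, (crossingProb half M N) ^ (k + 1) :=
        sum_real_frontierEvent_le hM
    _ ≤ ∑ k ∈ Finset.range (frontierFamily M N).card, q ^ (k + 1) :=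
        Finset.sum_le_sum fun k _ => pow_le_pow_left₀ hq0 hq (k + 1)
    _ ≤ q / (1 - q) := Literature.NumberTheory.LFunctions.VdC.sum_pow_succ_le (hq0.trans hq) hq1 _

end Expectation

/-! ### `P_{1/2}(LR) ≤ 1 - c` at bounded aspect ratio: Nolin's `1 - δ'` -/

/-- **The left–right crossing of a rectangle of aspect ratio at most `9` fails with probability
at least the RSW constant of the `9 × 1` rectangle**: there is `c > 0` with
`P_{1/2}(LR([0,M] × [0,N])) ≤ 1 - c` whenever `1 ≤ M` and `N + 2 ≤ 9 M` (duality
`P_{1/2}(LR(M, N)) + P_{1/2}(LR(N+1, M-1)) = 1` and `LR(N+1, M-1) ⊇ LR(9M-1, M-1)`, crossed the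
long way with probability `≥ c`). [cite: BollobasRiordan2006, Ch. 3, Corollary 3(i) and Theorem 8] -/
theorem exists_crossingProb_half_le_one_sub :
    ∃ c : ℝ, 0 < c ∧ ∀ M N : ℕ, 1 ≤ M → N + 2 ≤ 9 * M → crossingProb half M N ≤ 1 - c := by
  obtain ⟨c, hc, h⟩ := rsw_lowerBound_holds 9 (by norm_num)
  refine ⟨c, hc, fun M N hM hMN => ?_⟩
  have hdual := crossingProb_add_crossingProb_symm_holds half (M - 1) N
  rw [Nat.sub_add_cancel (by omega : 1 ≤ M), symm_half] at hdual
  have hlong : c ≤ crossingProb half (N + 1) (M - 1) :=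
    (h M (by omega)).trans (crossingProb_anti_left half (by omega) (M - 1))
  linarith

end Literature.Probability.Percolation

end
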